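import Summits.ValiantsHypothesis.ValiantsHypothesis.Theorems.KPlusLogSqLawTropicalBTwoRowsPerColumn
import Summits.ValiantsHypothesis.ValiantsHypothesis.Theorems.KPlusLogSqLawTropicalBTranspose

/-!
# Route `KPlusLogSqLaw`, crux `TropicalB` (stmt-ValiantsHypothesis-19771) — TWO PRESENT ENTRIES PER ROW are linear too
# (the two-rows law of `…TropicalBTwoRowsPerColumn` transported by `…TropicalBTranspose`), and the DEGREE-TWO SECTOR in one
# statement: at most two present entries in every column, OR in every row ⇒ `DesignRowD d v ε (2·K·m + m)`

HONEST FRAMING.  Helper file (seat val-sym-trop-p1 g14, cell `pub-symmetroid`, 2026-08-28) toward the registered stubs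
`stub_tropThin` / `stub_tropFat` of `Cruxes/TropicalB/Lines/birth.lean` (crux
`Summit.ValiantsHypothesis.ValiantsHypothesis.Theses.KPlusLogSqLaw.TropicalB`, item `stmt-ValiantsHypothesis-19771`, route
`KPlusLogSqLaw`; `--supports … --as helper`).  A twenty-line corollary of p593144 (`TwoRowsPerColumn.designRowD_of_twoRows`) and the
tree's transposition symmetry (`designRowD_of_transpose`): a design in which every ROW has at most two present entries (columns `τ₀ i`,
`τ₁ i` for two permutations) is the transpose of one with at most two present rows per column.  SECTOR law, every `K`, all exponents
and valuations; nothing here bounds `TropicalB` in its window or bears on `WeakLifting`, the doors, `MatrixDescartes`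
(stmt-ValiantsHypothesis-18050) or VP ≠ VNP.  With the paper remark that three present entries per column already host every
design (column fan-out, memo HOME/val-sym-trop-p1/g14/ODOMETER-ANATOMY-g14.md §6(d)), this closes the degree-two sector of the crux
on both sides. [folklore]
-/

set_option linter.dupNamespace false
set_option autoImplicit false

namespace Summit.ValiantsHypothesis.ValiantsHypothesis.Theorems.KPlusLogSqLaw

open Summit.ValiantsHypothesis.ValiantsHypothesis.Theorems.MatrixDescartes.Negative
open scoped BigOperators

namespace TwoRowsPerColumn

variable {m K : ℕ} {d : Fin K → ℕ} {v ε : Fin m → Fin m → Fin K → ℤ}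

/-- **TWO PRESENT COLUMNS PER ROW ARE LINEAR.**  If every present `(entry, class)` incidence lies in column `τ₀ i` or `τ₁ i` of its
row `i` (two permutations; any classes, exponents, valuations), the design has the unsigned row bound `2·K·m + m`. [folklore] -/
theorem designRowD_of_twoColumns (τ₀ τ₁ : Equiv.Perm (Fin m)) (hsupp : ∀ i j l, ε i j l ≠ 0 → j = τ₀ i ∨ j = τ₁ i) :
    DesignRowD d v ε (2 * K * m + m) :=
  designRowD_of_transpose d v ε
    (designRowD_of_twoRows (v := fun a b l => v b a l) (ε := fun a b l => ε b a l) τ₀ τ₁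
      (fun i j l h => hsupp j i l h))

/-- **THE DEGREE-TWO SECTOR.**  If the present entries of a design of format `(m, K)` lie on two permutation matrices — read
column-wise (`ε i j l ≠ 0 → i = σ₀ j ∨ i = σ₁ j`) or row-wise (`ε i j l ≠ 0 → j = τ₀ i ∨ j = τ₁ i`) — then every dominant chain
with pairwise distinct consecutive terms has `n ≤ 2·K·m + m`. [folklore] -/
theorem designRowD_of_degreeTwo
    (h : (∃ σ₀ σ₁ : Equiv.Perm (Fin m), ∀ i j l, ε i j l ≠ 0 → i = σ₀ j ∨ i = σ₁ j) ∨
         (∃ τ₀ τ₁ : Equiv.Perm (Fin m), ∀ i j l, ε i j l ≠ 0 → j = τ₀ i ∨ j = τ₁ i)) :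
    DesignRowD d v ε (2 * K * m + m) := by
  rcases h with ⟨σ₀, σ₁, hs⟩ | ⟨τ₀, τ₁, ht⟩
  · exact designRowD_of_twoRows σ₀ σ₁ hs
  · exact designRowD_of_twoColumns τ₀ τ₁ ht

end TwoRowsPerColumn

end Summit.ValiantsHypothesis.ValiantsHypothesis.Theorems.KPlusLogSqLaw
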